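import Summits.QuantumFields.BalabanUV.Beta.EriceFlowEnclosureThreeLoopTails

/-!
# Beta / EriceFlowEnclosureModulusTails — SERVICE FILE: THE HALF-INTEGER TELESCOPING TAILS Σ 1∕((j+1)²√(j+1)) (both ways),
# `(1 + log x)² ≤ 16√x`, AND THE UNIQUENESS OF AN EXPANSION `c + b∕K + o(1∕K)` — what the three-loop row needs when the Taylor
# remainder of the limit β at order two is a HALF-INTEGER power t²√t (the literal road (G) of [I] p. 264 WITHOUT parity, P2 #42p
# `T52_of_gsmooth`) instead of the integer power t³ of (T₃)
# (β-flow team, prover 2 = lower ∕ positivity side, unit `b2b-balaban-beta-bflow-p2`, gen 27; module P2 #44-A = service for P2 #44 ∕ #44b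
# `EriceFlowEnclosureThreeLoopModulus{Step,}` and P2 #44w `EriceFlowEnclosureFiveHalvesWitness`; companions bflow-p1 #45a
# `EriceFlowEnclosureThreeLoopTails` (the integer tails Σ log m∕m², Σ (1+log m)²∕m³) and #45b `EriceFlowEnclosureThreeLoopSharp` (`invCoeff_unique`
# at precision (1+log K)²∕K², generalised here to any o(1∕K) precision))

HONEST FRAMING (page 1 of everything the β sub-cell writes): discharging `BetaPertH` makes Bałaban's UV stability UNCONDITIONAL — a
real constructive-QFT result; it is NOT the continuum limit and NOT the Clay problem.  HONEST DEPENDENCY (cell reorg 2026-08-19,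
verbatim): «continuum YM on T⁴ ⇐ BetaPertH ∧ nine spine estimates (0/9 proved); BetaPertH ⇐ (D1) ∧ (D4) ∧ CAP+tail; G-an2-4 gates
asym, D1 and NE2/3/4.»  THIS MODULE DISCHARGES NOTHING and quotes nothing: [folklore] real analysis only (`√`-algebra, `log y ≤ y − 1`,
limits along the naturals); no Erice letter occurs.

THE POINT.  ∫_K^∞ dx∕x^{5∕2} = (2∕3)·K^{−3∕2}.  Discrete shadows that telescope against 1∕(x√x) with no transcendental constants: with
a = √x, b = √(x+1) (so b² − a² = 1, 0 < a ≤ b), `1∕a³ − 1∕b³ = (b − a)(a² + ab + b²)∕(a³b³)`, and `1∕(2b) ≤ b − a = 1∕(a+b) ≤ 1∕(2a)`,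
`b² ≤ a² + ab + b² ≤ 3b²` give **`1∕(2b⁵) ≤ 1∕a³ − 1∕b³ ≤ 3∕(2a⁵)`** — an UPPER tail `Σ_{K≤j<N} (j+1)^{−5∕2} ≤ 2(K^{−3∕2} − N^{−3∕2})`
and a LOWER tail `(2∕3)((K+τ)^{−3∕2} − (N+τ)^{−3∕2}) ≤ Σ_{K≤j<N} (j+τ)^{−5∕2}` (any shift τ > 0).  And `log x = 4 log x^{1∕4} ≤ 4(x^{1∕4} − 1)`
gives `(1 + log x)² ≤ 16√x` (x ≥ 1), so the squared-logarithm precision (1+log K)²∕K² of the integer road is FINER than the half-integer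
precision 1∕(K√K): `(1 + log K)²∕K² ≤ 16∕(K√K)`.

WHAT THIS FILE PROVES (0 sorry, 0 def, all [folklore]): §1 `inv_cube_sqrt_telescope_ge` ∕ `inv_cube_sqrt_telescope_le` (the two-sided
telescoping inequality above, in `√`-letters), `sum_Ico_inv_sq_sqrt_le` (Σ_{K≤j<N} 1∕((j+1)²√(j+1)) ≤ 2∕(K√K) − 2∕(N√N), 1 ≤ K ≤ N),
`sum_Ico_inv_sq_sqrt_le'` (≤ 2∕(K√K)), `sum_Ico_inv_sq_sqrt_shift_ge` (the lower tail with a shift τ > 0); §2 `one_add_log_sq_le_sqrt`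
((1 + log x)² ≤ 16√x on [1, ∞)), `logSq_div_sq_le_inv_sqrt` ((1 + log x)²∕x² ≤ 16∕(x√x), x ≥ 1), `logSq_div_sqrt_tendsto_zero`
((1 + log x)²∕√x → 0), `inv_sqrt_tendsto_zero_nat`; §3 **`invCoeff_unique_of_rate`** (two expansions `c + b∕K + O(w K)` of one sequence
with `K·w K → 0` have the same (c, b)) and its instance `invCoeff_unique_fiveHalves` (w K = 1∕(K√K)).
NOT CLAIMED: anything about (1.22), `BetaPertH`, continuum, Clay.
-/

namespace Summit.QuantumFields.BalabanUV.Beta.EriceFlowEnclosureModulusTails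

open Set Filter Topology

noncomputable section

/-! ## §1 The half-integer telescoping tails -/

/-- **Telescoping step, the tail from ABOVE**: for `0 < x`,
`1∕((x+1)²·√(x+1)) ≤ 2·(1∕(x·√x) − 1∕((x+1)·√(x+1)))` — with a = √x, b = √(x+1): `1∕(2b⁵) ≤ 1∕a³ − 1∕b³`
(`b − a ≥ 1∕(2b)`, `a² + ab + b² ≥ b²`). [folklore] -/
theorem inv_cube_sqrt_telescope_ge {x : ℝ} (hx : 0 < x) :
    1 / ((x + 1) ^ 2 * Real.sqrt (x + 1)) ≤ 2 * (1 / (x * Real.sqrt x) - 1 / ((x + 1) * Real.sqrt (x + 1))) := by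
  have hx1 : 0 < x + 1 := by linarith
  obtain ⟨a, ha⟩ : ∃ a : ℝ, a = Real.sqrt x := ⟨_, rfl⟩
  obtain ⟨b, hb⟩ : ∃ b : ℝ, b = Real.sqrt (x + 1) := ⟨_, rfl⟩
  have ha0 : 0 < a := ha ▸ Real.sqrt_pos.mpr hx
  have hb0 : 0 < b := hb ▸ Real.sqrt_pos.mpr hx1
  have ha2 : a ^ 2 = x := ha ▸ Real.sq_sqrt hx.le
  have hb2 : b ^ 2 = x + 1 := hb ▸ Real.sq_sqrt hx1.le
  have hab : a ≤ b := by rw [ha, hb]; exact Real.sqrt_le_sqrt (by linarith)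
  have hb2' : b ^ 2 = a ^ 2 + 1 := by rw [hb2, ha2]
  rw [← ha, ← hb, ← hb2, ← ha2]
  have hA : 0 < a ^ 2 * a := by positivity
  have hB : 0 < b ^ 2 * b := by positivity
  -- the polynomial heart: a³(1 + 2b²) ≤ 2b⁵ (from b² = a² + 1 and a ≤ b)
  have key : a ^ 2 * a * (1 + 2 * b ^ 2) ≤ 2 * (b ^ 2) ^ 2 * b := by
    have h1 : 2 * (a ^ 2 + 1) ^ 2 * a ≤ 2 * (a ^ 2 + 1) ^ 2 * b :=
      mul_le_mul_of_nonneg_left hab (by positivity)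
    rw [hb2']
    nlinarith [h1, pow_pos ha0 3, ha0]
  have e : 2 * (1 / (a ^ 2 * a) - 1 / (b ^ 2 * b)) = 2 * (b ^ 2 * b - a ^ 2 * a) / (a ^ 2 * a * (b ^ 2 * b)) := by
    field_simp
  rw [e, div_le_div_iff₀ (by positivity) (by positivity)]
  nlinarith [mul_nonneg hB.le (sub_nonneg.2 key)]

/-- **Telescoping step, the tail from BELOW**: for `0 < x`,
`(2∕3)·(1∕(x·√x) − 1∕((x+1)·√(x+1))) ≤ 1∕(x²·√x)` — with a = √x, b = √(x+1): `1∕a³ − 1∕b³ ≤ 3∕(2a⁵)`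
(`b − a ≤ 1∕(2a)`, `a² + ab + b² ≤ 3b²`, `a ≤ b`). [folklore] -/
theorem inv_cube_sqrt_telescope_le {x : ℝ} (hx : 0 < x) :
    2 / 3 * (1 / (x * Real.sqrt x) - 1 / ((x + 1) * Real.sqrt (x + 1))) ≤ 1 / (x ^ 2 * Real.sqrt x) := by
  have hx1 : 0 < x + 1 := by linarith
  obtain ⟨a, ha⟩ : ∃ a : ℝ, a = Real.sqrt x := ⟨_, rfl⟩
  obtain ⟨b, hb⟩ : ∃ b : ℝ, b = Real.sqrt (x + 1) := ⟨_, rfl⟩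
  have ha0 : 0 < a := ha ▸ Real.sqrt_pos.mpr hx
  have hb0 : 0 < b := hb ▸ Real.sqrt_pos.mpr hx1
  have ha2 : a ^ 2 = x := ha ▸ Real.sq_sqrt hx.le
  have hb2 : b ^ 2 = x + 1 := hb ▸ Real.sq_sqrt hx1.le
  have hab : a ≤ b := by rw [ha, hb]; exact Real.sqrt_le_sqrt (by linarith)
  have hb2' : b ^ 2 = a ^ 2 + 1 := by rw [hb2, ha2]
  rw [← ha, ← hb, ← hb2, ← ha2]
  have hA : 0 < a ^ 2 * a := by positivity
  have hB : 0 < b ^ 2 * b := by positivity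
  -- b ≤ a + 1∕(2a), i.e. 2ab ≤ 2a² + 1 (from (b − a)² ≥ 0 and b² = a² + 1)
  have hble : 2 * a * b ≤ 2 * a ^ 2 + 1 := by nlinarith [sq_nonneg (b - a), hb2']
  -- the polynomial heart: 2(b³ − a³)a² ≤ 3b³
  have key : 2 * (b ^ 2 * b - a ^ 2 * a) * a ^ 2 ≤ 3 * (b ^ 2 * b) := by
    have h1 : a ^ 3 * (2 * a * b) ≤ a ^ 3 * (2 * a ^ 2 + 1) := mul_le_mul_of_nonneg_left hble (pow_pos ha0 3).le
    have h2 : a ^ 2 * a ≤ a ^ 2 * b := mul_le_mul_of_nonneg_left hab (sq_nonneg a)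
    rw [hb2']
    nlinarith [h1, h2, hb0, ha0]
  have e : 2 / 3 * (1 / (a ^ 2 * a) - 1 / (b ^ 2 * b)) = 2 * (b ^ 2 * b - a ^ 2 * a) / (3 * (a ^ 2 * a * (b ^ 2 * b))) := by
    field_simp
  rw [e, div_le_div_iff₀ (by positivity) (by positivity)]
  nlinarith [mul_le_mul_of_nonneg_right key hA.le, hB]

/-- **The half-integer tail from above**: `Σ_{K≤j<N} 1∕((j+1)²·√(j+1)) ≤ 2∕(K·√K) − 2∕(N·√N)` for `1 ≤ K ≤ N`
(telescoping `inv_cube_sqrt_telescope_ge`; the discrete shadow of ∫_K^N x^{−5∕2} dx = (2∕3)(K^{−3∕2} − N^{−3∕2}), constant 2 for 2∕3). [folklore] -/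
theorem sum_Ico_inv_sq_sqrt_le {K N : ℕ} (hK : 1 ≤ K) (hKN : K ≤ N) :
    ∑ j ∈ Finset.Ico K N, 1 / (((j : ℝ) + 1) ^ 2 * Real.sqrt ((j : ℝ) + 1))
      ≤ 2 / ((K : ℝ) * Real.sqrt K) - 2 / ((N : ℝ) * Real.sqrt N) := by
  induction N, hKN using Nat.le_induction with
  | base => simp
  | succ N hKN ih =>
    rw [Finset.sum_Ico_succ_top hKN]
    have hNpos : (0 : ℝ) < N := by exact_mod_cast hK.trans hKN
    have hstep := inv_cube_sqrt_telescope_ge hNpos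
    push_cast
    have e : 2 * (1 / ((N : ℝ) * Real.sqrt N) - 1 / (((N : ℝ) + 1) * Real.sqrt ((N : ℝ) + 1)))
        = 2 / ((N : ℝ) * Real.sqrt N) - 2 / (((N : ℝ) + 1) * Real.sqrt ((N : ℝ) + 1)) := by ring
    linarith

/-- **The half-integer tail from above, short form**: `Σ_{K≤j<N} 1∕((j+1)²·√(j+1)) ≤ 2∕(K·√K)` for `1 ≤ K ≤ N`. [folklore] -/
theorem sum_Ico_inv_sq_sqrt_le' {K N : ℕ} (hK : 1 ≤ K) (hKN : K ≤ N) :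
    ∑ j ∈ Finset.Ico K N, 1 / (((j : ℝ) + 1) ^ 2 * Real.sqrt ((j : ℝ) + 1)) ≤ 2 / ((K : ℝ) * Real.sqrt K) := by
  have h := sum_Ico_inv_sq_sqrt_le hK hKN
  have h0 : 0 ≤ 2 / ((N : ℝ) * Real.sqrt N) := by positivity
  linarith

/-- **The half-integer tail from below, with a shift**: for `0 < τ` and `K ≤ N`,
`(2∕3)·(1∕((K+τ)·√(K+τ)) − 1∕((N+τ)·√(N+τ))) ≤ Σ_{K≤j<N} 1∕((j+τ)²·√(j+τ))` (telescoping `inv_cube_sqrt_telescope_le`). [folklore] -/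
theorem sum_Ico_inv_sq_sqrt_shift_ge {τ : ℝ} (hτ : 0 < τ) {K N : ℕ} (hKN : K ≤ N) :
    2 / 3 * (1 / (((K : ℝ) + τ) * Real.sqrt ((K : ℝ) + τ)) - 1 / (((N : ℝ) + τ) * Real.sqrt ((N : ℝ) + τ)))
      ≤ ∑ j ∈ Finset.Ico K N, 1 / ((((j : ℝ) + τ)) ^ 2 * Real.sqrt ((j : ℝ) + τ)) := by
  induction N, hKN using Nat.le_induction with
  | base => simp
  | succ N hKN ih =>
    rw [Finset.sum_Ico_succ_top hKN]
    have hNτ : (0 : ℝ) < (N : ℝ) + τ := by positivity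
    have hstep := inv_cube_sqrt_telescope_le hNτ
    push_cast
    have e1 : (N : ℝ) + 1 + τ = (N : ℝ) + τ + 1 := by ring
    rw [e1]
    linarith

/-! ## §2 The squared logarithm against the square root -/

/-- **`(1 + log x)² ≤ 16·√x` for `1 ≤ x`**: with y = x^{1∕4} ≥ 1, `log x = 4 log y ≤ 4(y − 1)`, so `0 ≤ 1 + log x ≤ 4y` and
`(1 + log x)² ≤ 16y² = 16√x`. [folklore] -/
theorem one_add_log_sq_le_sqrt {x : ℝ} (hx : 1 ≤ x) : (1 + Real.log x) ^ 2 ≤ 16 * Real.sqrt x := by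
  have hx0 : 0 ≤ x := by linarith
  set y : ℝ := Real.sqrt (Real.sqrt x) with hy
  have hsx1 : 1 ≤ Real.sqrt x := by rw [← Real.sqrt_one]; exact Real.sqrt_le_sqrt hx
  have hy1 : 1 ≤ y := by rw [hy, ← Real.sqrt_one]; exact Real.sqrt_le_sqrt hsx1
  have hy0 : 0 < y := by linarith
  have hy2 : y ^ 2 = Real.sqrt x := by rw [hy]; exact Real.sq_sqrt (by linarith)
  have hy4 : y ^ 4 = x := by
    rw [show (4 : ℕ) = 2 * 2 by norm_num, pow_mul, hy2]; exact Real.sq_sqrt hx0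
  have hlog : Real.log x = 4 * Real.log y := by
    rw [← hy4, Real.log_pow]; norm_num
  have hly : Real.log y ≤ y - 1 := Real.log_le_sub_one_of_pos hy0
  have hlx0 : 0 ≤ Real.log x := Real.log_nonneg hx
  rw [← hy2]
  nlinarith [hlog, hly, hlx0, hy0]

/-- **The squared-logarithm precision is finer than the half-integer one**: `(1 + log x)²∕x² ≤ 16∕(x·√x)` for `1 ≤ x`. [folklore] -/
theorem logSq_div_sq_le_inv_sqrt {x : ℝ} (hx : 1 ≤ x) :
    (1 + Real.log x) ^ 2 / x ^ 2 ≤ 16 / (x * Real.sqrt x) := by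
  have hx0 : 0 < x := by linarith
  have hsx : 0 < Real.sqrt x := Real.sqrt_pos.mpr hx0
  have h := one_add_log_sq_le_sqrt hx
  rw [div_le_div_iff₀ (by positivity) (by positivity)]
  have e : (16 : ℝ) * x ^ 2 = 16 * Real.sqrt x * (x * Real.sqrt x) := by
    have := Real.mul_self_sqrt hx0.le
    rw [sq]
    nlinarith [this]
  rw [e]
  exact mul_le_mul_of_nonneg_right h (by positivity)

/-- `(1 + log x)²∕√x → 0` as `x → ∞` (`log x = 2 log √x` and `logⁿ u∕u → 0`). [folklore] -/
theorem logSq_div_sqrt_tendsto_zero : Tendsto (fun x : ℝ => (1 + Real.log x) ^ 2 / Real.sqrt x) atTop (𝓝 0) := by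
  -- g u := (1 + 2 log u)²∕u → 0
  have h0 : Tendsto (fun u : ℝ => Real.log u ^ 0 / u) atTop (𝓝 0) := by
    have := Real.tendsto_pow_log_div_mul_add_atTop 1 0 0 one_ne_zero; simpa using this
  have h1 : Tendsto (fun u : ℝ => Real.log u ^ 1 / u) atTop (𝓝 0) := by
    have := Real.tendsto_pow_log_div_mul_add_atTop 1 0 1 one_ne_zero; simpa using this
  have h2 : Tendsto (fun u : ℝ => Real.log u ^ 2 / u) atTop (𝓝 0) := by
    have := Real.tendsto_pow_log_div_mul_add_atTop 1 0 2 one_ne_zero; simpa using this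
  have hg : Tendsto (fun u : ℝ => (1 + 2 * Real.log u) ^ 2 / u) atTop (𝓝 0) := by
    have h3 := (h0.add (h1.const_mul 4)).add (h2.const_mul 4)
    rw [mul_zero, add_zero, add_zero] at h3
    refine h3.congr fun u => ?_
    simp only [pow_zero, pow_one]
    ring
  have hcomp := hg.comp Real.tendsto_sqrt_atTop
  refine hcomp.congr' ?_
  filter_upwards [eventually_ge_atTop (0 : ℝ)] with x hx
  simp only [Function.comp]
  rw [Real.log_sqrt hx]
  ring_nf

/-- `(1 + log K)²∕√K → 0` along the naturals. [folklore] -/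
theorem logSq_div_sqrt_tendsto_zero_nat :
    Tendsto (fun K : ℕ => (1 + Real.log K) ^ 2 / Real.sqrt K) atTop (𝓝 0) :=
  logSq_div_sqrt_tendsto_zero.comp tendsto_natCast_atTop_atTop

/-- `1∕√K → 0` along the naturals. [folklore] -/
theorem inv_sqrt_tendsto_zero_nat : Tendsto (fun K : ℕ => 1 / Real.sqrt K) atTop (𝓝 0) := by
  have h := (Real.tendsto_sqrt_atTop.comp tendsto_natCast_atTop_atTop).inv_tendsto_atTop
  refine h.congr fun K => ?_
  simp [Function.comp, one_div]

/-! ## §3 Uniqueness of an expansion `c + b∕K + o(1∕K)` -/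

/-- **Uniqueness of an expansion `c + b∕K + O(w K)` with `K·w K → 0`**: two such expansions of one sequence have the same (c, b)
(bflow-p1 #45b's `invCoeff_unique` is the case `w K = (1 + log K)²∕K²`; here ANY o(1∕K) precision, e.g. `1∕(K√K)`). [folklore] -/
theorem invCoeff_unique_of_rate {E w : ℕ → ℝ} {c c' b b' A A' : ℝ}
    (hw : Tendsto (fun K : ℕ => (K : ℝ) * w K) atTop (𝓝 0))
    (h : ∀ K : ℕ, 1 ≤ K → |E K - c - b * (1 / K)| ≤ A * w K)
    (h' : ∀ K : ℕ, 1 ≤ K → |E K - c' - b' * (1 / K)| ≤ A' * w K) :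
    c = c' ∧ b = b' := by
  have hK0 : Tendsto (fun K : ℕ => (1 : ℝ) / K) atTop (𝓝 0) := tendsto_one_div_atTop_nhds_zero_nat
  -- w K = (K·w K)·(1∕K) → 0
  have hw0 : Tendsto w atTop (𝓝 0) := by
    have h1 := hw.mul hK0
    rw [zero_mul] at h1
    refine h1.congr' ?_
    filter_upwards [Filter.eventually_ge_atTop 1] with K hK
    have hKne : (K : ℝ) ≠ 0 := by positivity
    field_simp
  have hdiff : ∀ K : ℕ, 1 ≤ K → |(c - c') + (b - b') * (1 / K)| ≤ (A + A') * w K := by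
    intro K hK
    have e : (c - c') + (b - b') * (1 / K) = (E K - c' - b' * (1 / K)) - (E K - c - b * (1 / K)) := by ring
    rw [e]
    calc |(E K - c' - b' * (1 / K)) - (E K - c - b * (1 / K))|
        ≤ |E K - c' - b' * (1 / K)| + |E K - c - b * (1 / K)| := abs_sub _ _
      _ ≤ A' * w K + A * w K := add_le_add (h' K hK) (h K hK)
      _ = (A + A') * w K := by ring
  -- c = c'
  have hcc : c = c' := by
    have hL : Tendsto (fun K : ℕ => |(c - c') + (b - b') * (1 / K)|) atTop (𝓝 |(c - c') + (b - b') * 0|) :=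
      (continuous_abs.tendsto _).comp (tendsto_const_nhds.add (hK0.const_mul _))
    rw [mul_zero, add_zero] at hL
    have hR : Tendsto (fun K : ℕ => (A + A') * w K) atTop (𝓝 ((A + A') * 0)) := hw0.const_mul _
    rw [mul_zero] at hR
    have := le_of_tendsto_of_tendsto hL hR (Filter.eventually_atTop.mpr ⟨1, fun K hK => hdiff K hK⟩)
    have h0 : |c - c'| = 0 := le_antisymm this (abs_nonneg _)
    linarith [abs_eq_zero.mp h0]
  refine ⟨hcc, ?_⟩
  -- b = b': multiply by K
  have hdiff' : ∀ K : ℕ, 1 ≤ K → |b - b'| ≤ (A + A') * ((K : ℝ) * w K) := by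
    intro K hK
    have hKpos : (0 : ℝ) < K := by exact_mod_cast hK
    have h1 := hdiff K hK
    rw [hcc, sub_self, zero_add, abs_mul, abs_of_pos (by positivity : (0 : ℝ) < 1 / K)] at h1
    have h2 := mul_le_mul_of_nonneg_right h1 hKpos.le
    have e1 : |b - b'| * (1 / (K : ℝ)) * K = |b - b'| := by field_simp
    have e2 : (A + A') * w K * K = (A + A') * ((K : ℝ) * w K) := by ring
    rw [e1, e2] at h2
    exact h2
  have hR : Tendsto (fun K : ℕ => (A + A') * ((K : ℝ) * w K)) atTop (𝓝 ((A + A') * 0)) := hw.const_mul _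
  rw [mul_zero] at hR
  have := le_of_tendsto_of_tendsto tendsto_const_nhds hR (Filter.eventually_atTop.mpr ⟨1, fun K hK => hdiff' K hK⟩)
  have h0 : |b - b'| = 0 := le_antisymm this (abs_nonneg _)
  linarith [abs_eq_zero.mp h0]

/-- **Uniqueness at the half-integer precision**: two expansions `c + b∕K + O(1∕(K√K))` of one sequence have the same (c, b). [folklore] -/
theorem invCoeff_unique_fiveHalves {E : ℕ → ℝ} {c c' b b' A A' : ℝ}
    (h : ∀ K : ℕ, 1 ≤ K → |E K - c - b * (1 / K)| ≤ A * (1 / ((K : ℝ) * Real.sqrt K)))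
    (h' : ∀ K : ℕ, 1 ≤ K → |E K - c' - b' * (1 / K)| ≤ A' * (1 / ((K : ℝ) * Real.sqrt K))) :
    c = c' ∧ b = b' := by
  refine invCoeff_unique_of_rate (w := fun K : ℕ => 1 / ((K : ℝ) * Real.sqrt K)) ?_ h h'
  refine inv_sqrt_tendsto_zero_nat.congr' ?_
  filter_upwards [Filter.eventually_ge_atTop 1] with K hK
  have hKpos : (0 : ℝ) < K := by exact_mod_cast hK
  have hsK : 0 < Real.sqrt K := Real.sqrt_pos.mpr hKpos
  field_simp

end

end Summit.QuantumFields.BalabanUV.Beta.EriceFlowEnclosureModulusTails
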